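import Summits.CriticalPhenomena.CardyFormulaZ2.Theorems.CardyWhiteToColouredSimilarityUpgradeStubHeartLShape
import Summits.CriticalPhenomena.CardyFormulaZ2.Theorems.CardyIKTransportRenewalGridHarmlessModuli
import Summits.CriticalPhenomena.CardyFormulaZ2.Theorems.CardyMeckeFlipLawToCrossingsQuads
import Literature.Probability.RandomPlanarGeometry.ModulusSymmetry

/-!
# Stub `stub_heartOfSymmetric` (line `registered`, crux `SimilarityUpgrade`, stmt-CriticalPhenomena-4597)

Crux `Summit.CriticalPhenomena.CardyFormulaZ2.Theses.CardyWhiteToColoured.SimilarityUpgrade`,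
route `CardyWhiteToColoured`, sub-problem `CardyFormulaZ2`, line `registered`, stub (W2-2)
`stub_heartOfSymmetric`: the open heart H3 of the crux — a full bond-`ℤ²` crossing limit `Φ` takes
the same value on a conformal rectangle `R` and on the corner-marked box
`R' = ((0,w)×(0,1); i, 0, w, w+i)` (arcs `0/2` = left/right sides) of equal conformal modulus — on
the whole AFFINELY ANTISYMMETRIC family: `R` is invariant under an anti-conformal affine involution
`σ z = u z̄ + v` (`u ∈ {±1, ±i}`, `u v̄ + v = 0`) exchanging the two arc pairs and either fixing the
marks `0, 2` and sending mark `1 ↦ 3` (class A) or fixing the marks `1, 3` and sending mark `0 ↦ 2`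
(class B), GIVEN (hypothesis 1, a neighbouring stub) that full limits of affinely antisymmetric
rectangles are `1/2`.

Proof.
* `Φ R = 1/2`: hypothesis 1.
* `crossRatio x = 1/2`. Class A is the tree's symmetry principle
  `ConformalRectangle.crossRatio_eq_half_of_antiAffine` (Ahlfors' reflection principle). Class B is
  reduced to class A by re-marking: the cyclically re-marked rectangle `R₁ = (Ω; P₁, P₂, P₃, P₀)`
  (`MeckeFlipBridge.exists_shift1`) is of class A for the same `σ` (`σ` is an involution,
  `antiAffine_antiAffine`, so `σ P₂ = P₀`), hence has modulus `1/2`, and the conjugate marking has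
  modulus `1 - η` (`RenewalGridHarmless.crossRatio_eq_one_sub_of_pt_eq_succ`), so `η = 1 - 1/2`.
* `w = 1`: the box `R'` then has modulus `1/2`, which forces `w = 1`
  (`heartLShape_width_eq_one`, Bollobás–Riordan's strict monotonicity of the modulus in the aspect
  ratio).
* `Φ R' = 1/2`: `R'` is the unit square crossed left-to-right, whose bond-`ℤ²` crossing
  probability tends to `1/2` (`tendsto_bondDomainCrossingProb_lrSquare`); limits along the
  non-trivial filter `𝓝[>] 0` are unique.

No definitions are introduced.

References: L. V. Ahlfors, *Complex Analysis* (1979), Ch. 3 §3.1 (cross-ratio), Ch. 4 §6.5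
(reflection principle); V. Beffara, *Is critical 2D percolation universal?*, Progr. Probab. 60
(2008), proof of Prop. 4 (conjugate marking has modulus `1 - η`); B. Bollobás, O. Riordan,
*Percolation* (2006), Ch. 7 §7.1; J. Cardy, J. Phys. A 25 (1992) L201.
-/

noncomputable section

namespace Summit.CriticalPhenomena.CardyFormulaZ2.Cruxes.SimilarityUpgrade.Stubs

open Filter Topology Set MeasureTheory
open Literature.Probability.RandomPlanarGeometry
open Literature.Probability.Percolation
open scoped ComplexConjugate

/-- The four lattice units `1, -1, i, -i` have norm `1`. [folklore] -/
theorem heartOfSymmetric_norm_eq_one {u : ℂ} (hu : u = 1 ∨ u = -1 ∨ u = Complex.I ∨ u = -Complex.I) :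
    ‖u‖ = 1 := by
  rcases hu with rfl | rfl | rfl | rfl <;> simp

/-- If `z ↦ u z̄ + v` maps the carrier of `R` onto itself, then `antiAffine u v` maps the carrier
into itself. [folklore] -/
theorem heartOfSymmetric_mapsTo (R : ConformalRectangle) {u v : ℂ}
    (hcar : (fun z : ℂ => u * conj z + v) '' R.carrier = R.carrier) :
    MapsTo (antiAffine u v) R.carrier R.carrier :=
  fun z hz => hcar.subset ⟨z, hz, rfl⟩

/-- **Class B of the symmetry principle.** If an anti-conformal affine involution
`σ z = u z̄ + v` (`‖u‖ = 1`, `u v̄ + v = 0`) maps the carrier of the conformal rectangle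
`(Ω; P₀, P₁, P₂, P₃)` into itself, fixes `P₁`, `P₃` and sends `P₀ ↦ P₂`, then every uniformizing
datum has cross-ratio `1/2`: the re-marked rectangle `(Ω; P₁, P₂, P₃, P₀)` is of class A
(`ConformalRectangle.crossRatio_eq_half_of_antiAffine`), so has modulus `1/2`, and the conjugate
marking has modulus `1 - η` (`crossRatio_eq_one_sub_of_pt_eq_succ`). Beffara (2008), proof of
Prop. 4; Ahlfors (1979), Ch. 4 §6.5. [folklore] -/
theorem heartOfSymmetric_crossRatio_eq_half_classB (R : ConformalRectangle) {u v : ℂ}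
    (hu : ‖u‖ = 1) (huv : u * conj v + v = 0)
    (hmaps : MapsTo (antiAffine u v) R.carrier R.carrier)
    (h1 : antiAffine u v (R.pt 1) = R.pt 1) (h3 : antiAffine u v (R.pt 3) = R.pt 3)
    (h0 : antiAffine u v (R.pt 0) = R.pt 2)
    {φ : ConformalEquiv UpperHalfPlane.upperHalfPlaneSet R.carrier} {x : Fin 4 → ℝ}
    (h : R.IsUniformizing φ x) : crossRatio x = 1 / 2 := by
  obtain ⟨R₁, hc, hp, -, -, -, -⟩ :=
    Summit.CriticalPhenomena.CardyFormulaZ2.Theorems.MeckeFlipBridge.exists_shift1 R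
  obtain ⟨φ₁, x₁, hφ₁⟩ := MarkedDomain.exists_isUniformizing_holds R₁
  have h2 : antiAffine u v (R.pt 2) = R.pt 0 := by rw [← h0, antiAffine_antiAffine hu huv]
  have e0 : ((0 : Fin 4) + 1) = 1 := rfl
  have e1 : ((1 : Fin 4) + 1) = 2 := rfl
  have e2 : ((2 : Fin 4) + 1) = 3 := rfl
  have e3 : ((3 : Fin 4) + 1) = 0 := rfl
  -- the re-marked rectangle is of class A, hence has modulus `1/2`
  have hx₁ : crossRatio x₁ = 1 / 2 := by
    refine ConformalRectangle.crossRatio_eq_half_of_antiAffine R₁ hu huv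
      (by rw [hc]; exact hmaps) ?_ ?_ ?_ hφ₁
    · rw [hp, e0]; exact h1
    · rw [hp, e2]; exact h3
    · rw [hp, hp, e1, e3]; exact h2
  -- the conjugate marking has modulus `1 - η`
  have key : crossRatio x₁ = 1 - crossRatio x :=
    Summit.CriticalPhenomena.CardyFormulaZ2.Theorems.CardyIKTransport.RenewalGridHarmless.crossRatio_eq_one_sub_of_pt_eq_succ
      hc hp h hφ₁
  linarith

/-- **Affinely antisymmetric rectangles have modulus `1/2`** (both classes): if
`σ z = u z̄ + v` (`u ∈ {±1, ±i}`, `u v̄ + v = 0`) maps the carrier onto itself and either fixes the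
marks `0, 2` and sends `1 ↦ 3`, or fixes the marks `1, 3` and sends `0 ↦ 2`, then every
uniformizing datum has cross-ratio `1/2`. [folklore] -/
theorem heartOfSymmetric_crossRatio_eq_half (R : ConformalRectangle) {u v : ℂ}
    (hu : u = 1 ∨ u = -1 ∨ u = Complex.I ∨ u = -Complex.I) (huv : u * conj v + v = 0)
    (hcar : (fun z : ℂ => u * conj z + v) '' R.carrier = R.carrier)
    (hpts : (u * conj (R.pt 0) + v = R.pt 0 ∧ u * conj (R.pt 2) + v = R.pt 2 ∧
        u * conj (R.pt 1) + v = R.pt 3) ∨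
      (u * conj (R.pt 1) + v = R.pt 1 ∧ u * conj (R.pt 3) + v = R.pt 3 ∧
        u * conj (R.pt 0) + v = R.pt 2))
    {φ : ConformalEquiv UpperHalfPlane.upperHalfPlaneSet R.carrier} {x : Fin 4 → ℝ}
    (h : R.IsUniformizing φ x) : crossRatio x = 1 / 2 := by
  have hn : ‖u‖ = 1 := heartOfSymmetric_norm_eq_one hu
  have hmaps : MapsTo (antiAffine u v) R.carrier R.carrier := heartOfSymmetric_mapsTo R hcar
  rcases hpts with ⟨h0, h2, h1⟩ | ⟨h1, h3, h0⟩
  · exact ConformalRectangle.crossRatio_eq_half_of_antiAffine R hn huv hmaps h0 h2 h1 h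
  · exact heartOfSymmetric_crossRatio_eq_half_classB R hn huv hmaps h1 h3 h0 h

/-- **stub_heartOfSymmetric (W2-2).** The heart H3 of the crux on the affinely antisymmetric
family: GIVEN that full bond-`ℤ²` crossing limits of affinely antisymmetric rectangles are `1/2`
(hypothesis 1), every full crossing limit `Φ` takes the same value on an affinely antisymmetric
rectangle `R` (invariant under the involution `σ z = u z̄ + v`, `u ∈ {±1, ±i}`, exchanging the arc
pairs, of class A or B on the marks) and on any corner-marked box `((0,w)×(0,1); i, 0, w, w+i)`
(crossed left-to-right) of the same conformal modulus — because that modulus is `1/2`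
(`heartOfSymmetric_crossRatio_eq_half`), which forces `w = 1` (`heartLShape_width_eq_one`), and
the unit square is crossed with probability `→ 1/2` (`tendsto_bondDomainCrossingProb_lrSquare`);
limits along `𝓝[>] 0` are unique. [folklore] -/
theorem stub_heartOfSymmetric :
    (∀ Φ : ConformalRectangle → ℝ,
      (∀ R : ConformalRectangle, Tendsto (bondDomainCrossingProb R) (𝓝[>] (0 : ℝ)) (𝓝 (Φ R))) →
      ∀ (R : ConformalRectangle) (u v : ℂ), (u = 1 ∨ u = -1 ∨ u = Complex.I ∨ u = -Complex.I) →
        (fun z : ℂ => u * (starRingEnd ℂ) z + v) '' R.carrier = R.carrier →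
        ((fun z : ℂ => u * (starRingEnd ℂ) z + v) '' R.arc 0 = R.arc 1 ∧
            (fun z : ℂ => u * (starRingEnd ℂ) z + v) '' R.arc 2 = R.arc 3 ∨
          (fun z : ℂ => u * (starRingEnd ℂ) z + v) '' R.arc 0 = R.arc 3 ∧
            (fun z : ℂ => u * (starRingEnd ℂ) z + v) '' R.arc 2 = R.arc 1) →
        Φ R = 1 / 2) →
    ∀ Φ : ConformalRectangle → ℝ,
      (∀ R : ConformalRectangle, Tendsto (bondDomainCrossingProb R) (𝓝[>] (0 : ℝ)) (𝓝 (Φ R))) →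
      ∀ (R : ConformalRectangle) (u v : ℂ), (u = 1 ∨ u = -1 ∨ u = Complex.I ∨ u = -Complex.I) →
        u * (starRingEnd ℂ) v + v = 0 →
        (fun z : ℂ => u * (starRingEnd ℂ) z + v) '' R.carrier = R.carrier →
        ((fun z : ℂ => u * (starRingEnd ℂ) z + v) '' R.arc 0 = R.arc 1 ∧
            (fun z : ℂ => u * (starRingEnd ℂ) z + v) '' R.arc 2 = R.arc 3 ∨
          (fun z : ℂ => u * (starRingEnd ℂ) z + v) '' R.arc 0 = R.arc 3 ∧
            (fun z : ℂ => u * (starRingEnd ℂ) z + v) '' R.arc 2 = R.arc 1) →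
        ((u * (starRingEnd ℂ) (R.pt 0) + v = R.pt 0 ∧ u * (starRingEnd ℂ) (R.pt 2) + v = R.pt 2 ∧
            u * (starRingEnd ℂ) (R.pt 1) + v = R.pt 3) ∨
          (u * (starRingEnd ℂ) (R.pt 1) + v = R.pt 1 ∧ u * (starRingEnd ℂ) (R.pt 3) + v = R.pt 3 ∧
            u * (starRingEnd ℂ) (R.pt 0) + v = R.pt 2)) →
        ∀ R' : ConformalRectangle,
          (∃ w : ℝ, 0 < w ∧ R'.carrier = (Ioo (0 : ℝ) w ×ℂ Ioo (0 : ℝ) 1) ∧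
            R'.arc 0 = {z : ℂ | z.re = 0 ∧ z.im ∈ Icc (0 : ℝ) 1} ∧
            R'.arc 2 = {z : ℂ | z.re = w ∧ z.im ∈ Icc (0 : ℝ) 1} ∧
            R'.pt 0 = Complex.I ∧ R'.pt 1 = 0 ∧ R'.pt 2 = (w : ℂ) ∧ R'.pt 3 = (w : ℂ) + Complex.I) →
          ∀ (φ : ConformalEquiv UpperHalfPlane.upperHalfPlaneSet R.carrier) (x : Fin 4 → ℝ)
            (φ' : ConformalEquiv UpperHalfPlane.upperHalfPlaneSet R'.carrier) (x' : Fin 4 → ℝ),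
            R.IsUniformizing φ x → R'.IsUniformizing φ' x' → crossRatio x = crossRatio x' →
            Φ R = Φ R' := by
  intro hhalf Φ hlim R u v hu huv hcar harcs hpts R' hR' φ x φ' x' hφ hφ' hxx'
  obtain ⟨w, hw, hcar', ha0, ha2, hpt⟩ := hR'
  -- `Φ R = 1/2` (hypothesis 1)
  have hΦR : Φ R = 1 / 2 := hhalf Φ hlim R u v hu hcar harcs
  -- the common modulus is `1/2`, so `w = 1`
  have hx : crossRatio x = 1 / 2 := heartOfSymmetric_crossRatio_eq_half R hu huv hcar hpts hφ
  have hx' : crossRatio x' = 1 / 2 := hxx' ▸ hx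
  obtain rfl : w = 1 := heartLShape_width_eq_one R' hw hcar' hpt hφ' hx'
  -- `Φ R' = 1/2`: the unit square crossed left-to-right
  have hR'lim : Tendsto (bondDomainCrossingProb R') (𝓝[>] (0 : ℝ)) (𝓝 (1 / 2)) :=
    Summit.CriticalPhenomena.CardyFormulaZ2.Cruxes.SubseqCardy.Birth.tendsto_bondDomainCrossingProb_lrSquare
      (x₀ := 0) (y₀ := 0) one_pos R' (by simpa using hcar') (by simpa using ha0) (by simpa using ha2)
  have hΦR' : Φ R' = 1 / 2 := tendsto_nhds_unique (hlim R') hR'lim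
  rw [hΦR, hΦR']

end Summit.CriticalPhenomena.CardyFormulaZ2.Cruxes.SimilarityUpgrade.Stubs

end
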